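import Mathlib
import Literature.MathematicalPhysics.QuantumFieldTheory.CircleHaarAngle
import HarnessLib

/-!
# Stub A — abelian pushforward of Haar under an integer linear map

For finite index types `E` (links) and `P` (plaquettes), an `ℝ`-linear map `d : ℝ^E → ℝ^P`
with integer coefficients `n`, and the product Haar probability on `Circle^E`: writing
`ρ U := d (arg ∘ U) ∈ V := im d` and `Γ := {γ ∈ V | γ_p ∈ 2πℤ ∀ p}` (the period lattice),
the `Γ`-periodised law `ν := ∑_{γ ∈ Γ} (law of ρ U + γ)` of `ρ` is a constant multiple of
Lebesgue measure on the subspace `V`.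

Proof: `ν` is translation invariant under `V` (for `t = d θ ∈ V`, multiplying `U` by `e^{iθ}`
shifts `arg ∘ U` by `θ` up to `2πℤ^E`, and `d (2πℤ^E) ⊆ Γ` because the coefficients are
integers, so the sum over `Γ` absorbs the defect; then invariance of the product Haar
measure), `ν` is finite on compact sets (`ρ` is bounded and `Γ` is uniformly discrete), hence
`ν = c • volume` by uniqueness of Haar measure on the finite-dimensional space `V`; `c ≠ 0`
since `ν ≥ law of ρ ≠ 0`.  Everything is proved and no named fact is introduced; the objects
`Γ`, `ρ`, `ν` are file-local notations.
-/

noncomputable section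

open scoped ENNReal
open MeasureTheory Literature.MathematicalPhysics.QuantumFieldTheory

namespace Summit.QuantumFields.YangMills.Theorems.SelfNormalisedSkewness.Negative

section AbelianPushforward

variable {E P : Type} [Fintype E] [Fintype P] (d : (E → ℝ) →ₗ[ℝ] EuclideanSpace ℝ P)

set_option quotPrecheck false in
/-- The period lattice `Γ = {γ ∈ im d | γ_p ∈ 2πℤ ∀ p}` as a subtype of `V = im d`
(file-local notation). [folklore] -/
local notation "Γper" =>
  {v : LinearMap.range d // ∀ p : P, ∃ m : ℤ, (v : EuclideanSpace ℝ P) p = 2 * Real.pi * m}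

set_option quotPrecheck false in
/-- `ρ U := d (arg ∘ U) ∈ V = im d` (file-local notation). [folklore] -/
local notation "ρarg" U:max =>
  (⟨d (fun e => Complex.arg (U e : ℂ)), LinearMap.mem_range_self d _⟩ : LinearMap.range d)

set_option quotPrecheck false in
/-- The product Haar probability measure on `Circle^E` (file-local notation). [folklore] -/
local notation "μHaar" => (Measure.pi fun _ : E => haarProbability Circle : Measure (E → Circle))

set_option quotPrecheck false in
/-- The `Γ`-periodised law of `ρ`: `ν := ∑_{γ ∈ Γ} (Haar^E).map (U ↦ ρ U + γ)`
(file-local notation). [folklore] -/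
local notation "νper" =>
  (Measure.sum fun γ : Γper =>
    Measure.map (fun U : E → Circle => ρarg U + (γ : LinearMap.range d)) μHaar)

omit [Fintype E] in
/-- `Γ` is countable: `γ ↦ (γ_p / 2π)_p ∈ ℤ^P` is injective. [folklore] -/
theorem countable_perLat : Countable Γper := by
  choose m hm using fun γ : Γper => γ.2
  refine Function.Injective.countable (f := m) fun γ₁ γ₂ h => ?_
  apply Subtype.ext
  apply Subtype.ext
  ext p
  rw [hm γ₁ p, hm γ₂ p, h]

/-- `ρ` is measurable (`arg` is measurable, `d` is continuous). [folklore] -/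
theorem measurable_rho : Measurable fun U : E → Circle => ρarg U := by
  refine Measurable.subtype_mk ?_
  refine (LinearMap.continuous_of_finiteDimensional d).measurable.comp ?_
  have hcoe : Measurable fun z : Circle => (z : ℂ) := by
    apply Continuous.measurable
    exact continuous_subtype_val
  exact measurable_pi_lambda _ fun e =>
    Complex.measurable_arg.comp (hcoe.comp (measurable_pi_apply e))

/-- Integration against the periodised law: `∫ F dν = ∫ ∑_γ F (ρ U + γ) dHaar(U)`. [folklore] -/
theorem lintegral_per {F : LinearMap.range d → ℝ≥0∞} (hF : Measurable F) :
    ∫⁻ v, F v ∂νper = ∫⁻ U, ∑' γ : Γper, F (ρarg U + (γ : LinearMap.range d)) ∂μHaar := by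
  haveI := countable_perLat d
  rw [lintegral_sum_measure, lintegral_tsum]
  · refine tsum_congr fun γ => ?_
    exact lintegral_map hF ((measurable_rho d).add_const _)
  · intro γ
    exact (hF.comp ((measurable_rho d).add_const _)).aemeasurable

/-- `arg (e^{iθ} z) = arg z + θ (mod 2π)`. [folklore] -/
theorem arg_exp_mul (θ : ℝ) (z : Circle) : ∃ m : ℤ,
    Complex.arg ((Circle.exp θ * z : Circle) : ℂ) =
      Complex.arg (z : ℂ) + θ + 2 * Real.pi * m := by
  have h1 : (Complex.arg ((Circle.exp θ * z : Circle) : ℂ) : Real.Angle) =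
      (θ : Real.Angle) + Complex.arg (z : ℂ) := by
    rw [Circle.coe_mul,
      Complex.arg_mul_coe_angle (Circle.coe_ne_zero _) (Circle.coe_ne_zero _)]
    congr 1
    simpa using Real.Angle.arg_toCircle (θ : Real.Angle)
  rw [← Real.Angle.coe_add] at h1
  obtain ⟨k, hk⟩ := Real.Angle.angle_eq_iff_two_pi_dvd_sub.1 h1
  exact ⟨k, by linarith⟩

omit [Fintype P] in
/-- **Covariance of `ρ`**: multiplying `U` by `e^{iθ}` shifts `ρ U` by `d θ` plus an element of
the period lattice (integrality of the coefficients `n`). [folklore] -/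
theorem rho_exp_mul (n : P → E → ℤ) (hd : ∀ (θ : E → ℝ) (p : P), d θ p = ∑ e, (n p e : ℝ) * θ e)
    (θ : E → ℝ) (U : E → Circle) :
    ∃ γ : Γper, ρarg ((fun e => Circle.exp (θ e)) * U) =
      ρarg U + ⟨d θ, LinearMap.mem_range_self d _⟩ + (γ : LinearMap.range d) := by
  choose m hm using fun e => arg_exp_mul (θ e) (U e)
  refine ⟨⟨⟨d (fun e => 2 * Real.pi * (m e : ℝ)), LinearMap.mem_range_self d _⟩, fun p => ?_⟩,
    ?_⟩
  · refine ⟨∑ e, n p e * m e, ?_⟩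
    show d (fun e => 2 * Real.pi * (m e : ℝ)) p = _
    rw [hd]
    push_cast
    rw [Finset.mul_sum]
    exact Finset.sum_congr rfl fun e _ => by ring
  · apply Subtype.ext
    show d _ = d _ + d θ + d _
    rw [← map_add, ← map_add]
    congr 1
    funext e
    simp only [Pi.add_apply, Pi.mul_apply, hm e]

omit [Fintype E] [Fintype P] in
/-- `Γ` is closed under addition. [folklore] -/
theorem perLat_add_mem {v w : LinearMap.range d}
    (hv : ∀ p : P, ∃ m : ℤ, (v : EuclideanSpace ℝ P) p = 2 * Real.pi * m)
    (hw : ∀ p : P, ∃ m : ℤ, (w : EuclideanSpace ℝ P) p = 2 * Real.pi * m) :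
    ∀ p : P, ∃ m : ℤ, ((v + w : LinearMap.range d) : EuclideanSpace ℝ P) p = 2 * Real.pi * m := by
  intro p
  obtain ⟨a, ha⟩ := hv p
  obtain ⟨b, hb⟩ := hw p
  exact ⟨a + b, by rw [Submodule.coe_add, PiLp.add_apply, ha, hb]; push_cast; ring⟩

omit [Fintype E] [Fintype P] in
/-- `Γ` is closed under negation. [folklore] -/
theorem perLat_neg_mem {v : LinearMap.range d}
    (hv : ∀ p : P, ∃ m : ℤ, (v : EuclideanSpace ℝ P) p = 2 * Real.pi * m) :
    ∀ p : P, ∃ m : ℤ, ((-v : LinearMap.range d) : EuclideanSpace ℝ P) p = 2 * Real.pi * m := by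
  intro p
  obtain ⟨a, ha⟩ := hv p
  exact ⟨-a, by rw [Submodule.coe_neg, PiLp.neg_apply, ha]; push_cast; ring⟩

omit [Fintype P] in
/-- **Translation invariance** of the periodised functional `G ↦ ∫ ∑_γ G (ρ U + γ) dHaar(U)`
under `V = im d` (the translated sum over `Γ` is re-indexed by `γ ↦ γ₀ + γ`). [folklore] -/
theorem lintegral_tsum_translate (n : P → E → ℤ)
    (hd : ∀ (θ : E → ℝ) (p : P), d θ p = ∑ e, (n p e : ℝ) * θ e)
    (G : LinearMap.range d → ℝ≥0∞) (t : LinearMap.range d) :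
    ∫⁻ U, ∑' γ : Γper, G (t + (ρarg U + (γ : LinearMap.range d))) ∂μHaar =
      ∫⁻ U, ∑' γ : Γper, G (ρarg U + (γ : LinearMap.range d)) ∂μHaar := by
  obtain ⟨θ, hθ⟩ := LinearMap.mem_range.1 t.2
  haveI : (haarProbability Circle).IsMulLeftInvariant := by
    unfold haarProbability; infer_instance
  rw [← lintegral_mul_left_eq_self (μ := μHaar)
    (fun U => ∑' γ : Γper, G (ρarg U + (γ : LinearMap.range d))) (fun e => Circle.exp (θ e))]
  refine lintegral_congr fun U => ?_
  obtain ⟨γ₀, h⟩ := rho_exp_mul d n hd θ U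
  have ht : (⟨d θ, LinearMap.mem_range_self d θ⟩ : LinearMap.range d) = t := Subtype.ext hθ
  simp only [h, ht]
  let e : Γper ≃ Γper :=
    { toFun := fun γ => ⟨(γ₀ : LinearMap.range d) + γ, perLat_add_mem d γ₀.2 γ.2⟩
      invFun := fun γ => ⟨-(γ₀ : LinearMap.range d) + γ, perLat_add_mem d (perLat_neg_mem d γ₀.2) γ.2⟩
      left_inv := fun _ => Subtype.ext (neg_add_cancel_left _ _)
      right_inv := fun _ => Subtype.ext (add_neg_cancel_left _ _) }
  rw [← e.tsum_eq]
  refine tsum_congr fun γ => ?_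
  rw [show ((e γ : Γper) : LinearMap.range d) = γ₀ + γ from rfl]
  congr 1
  abel

/-- The periodised law is translation invariant. [folklore] -/
theorem per_isAddLeftInvariant (n : P → E → ℤ)
    (hd : ∀ (θ : E → ℝ) (p : P), d θ p = ∑ e, (n p e : ℝ) * θ e) :
    (νper).IsAddLeftInvariant := by
  refine ⟨fun t => Measure.ext fun A hA => ?_⟩
  rw [Measure.map_apply (measurable_const_add t) hA,
    ← lintegral_indicator_one (measurable_const_add t hA), ← lintegral_indicator_one hA,
    lintegral_per d (measurable_one.indicator hA),
    lintegral_per d (measurable_one.indicator (measurable_const_add t hA))]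
  have key : ∀ v : LinearMap.range d,
      ((fun x => t + x) ⁻¹' A).indicator (1 : LinearMap.range d → ℝ≥0∞) v =
        A.indicator 1 (t + v) := by
    intro v
    classical
    simp only [Set.indicator_apply, Set.mem_preimage, Pi.one_apply]
  simp only [key]
  exact lintegral_tsum_translate d n hd _ t

/-- `ρ` is bounded (`|arg| ≤ π` and `d` is continuous). [folklore] -/
theorem exists_norm_rho_le : ∃ R : ℝ, ∀ U : E → Circle, ‖ρarg U‖ ≤ R := by
  have hK : IsCompact (Set.pi Set.univ fun _ : E => Set.Icc (-Real.pi) Real.pi) :=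
    isCompact_univ_pi fun _ => isCompact_Icc
  obtain ⟨R, hR⟩ :=
    ((hK.image (LinearMap.continuous_of_finiteDimensional d)).isBounded).exists_norm_le
  refine ⟨R, fun U => ?_⟩
  rw [Submodule.coe_norm]
  exact hR _ ⟨_, fun e _ => ⟨(Complex.neg_pi_lt_arg _).le, Complex.arg_le_pi _⟩, rfl⟩

omit [Fintype E] in
/-- `Γ` is uniformly discrete: only finitely many of its points lie in a ball. [folklore] -/
theorem finite_perLat_norm_le (R : ℝ) :
    Set.Finite {γ : Γper | ‖(γ : LinearMap.range d)‖ ≤ R} := by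
  choose m hm using fun γ : Γper => γ.2
  have hinj : Function.Injective m := fun γ₁ γ₂ h => by
    apply Subtype.ext
    apply Subtype.ext
    ext p
    rw [hm γ₁ p, hm γ₂ p, h]
  obtain ⟨N, hN⟩ := exists_nat_ge (R / (2 * Real.pi))
  have hbox : Set.Finite {f : P → ℤ | ∀ p, f p ∈ Set.Icc (-(N : ℤ)) N} :=
    Set.Finite.pi' fun _ => Set.finite_Icc _ _
  refine (hbox.preimage hinj.injOn).subset fun γ hγ => ?_
  simp only [Set.mem_preimage, Set.mem_setOf_eq, Set.mem_Icc]
  intro p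
  have h1 : |((γ : LinearMap.range d) : EuclideanSpace ℝ P) p| ≤ R :=
    calc |((γ : LinearMap.range d) : EuclideanSpace ℝ P) p|
        = ‖((γ : LinearMap.range d) : EuclideanSpace ℝ P) p‖ := (Real.norm_eq_abs _).symm
      _ ≤ ‖((γ : LinearMap.range d) : EuclideanSpace ℝ P)‖ := PiLp.norm_apply_le _ _
      _ = ‖(γ : LinearMap.range d)‖ := (Submodule.coe_norm _).symm
      _ ≤ R := hγ
  rw [hm γ p, abs_mul, abs_of_pos Real.two_pi_pos] at h1
  have h2 : |(m γ p : ℝ)| ≤ N :=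
    calc |(m γ p : ℝ)| ≤ R / (2 * Real.pi) := by
          rw [le_div_iff₀ Real.two_pi_pos]; linarith
      _ ≤ N := hN
  rw [abs_le] at h2
  constructor
  · exact_mod_cast h2.1
  · exact_mod_cast h2.2

/-- The periodised law is finite on compact sets. [folklore] -/
theorem per_isFiniteMeasureOnCompacts : IsFiniteMeasureOnCompacts νper := by
  refine ⟨fun K hK => ?_⟩
  obtain ⟨R₀, hR₀⟩ := exists_norm_rho_le d
  obtain ⟨RK, hRK⟩ := hK.isBounded.exists_norm_le
  have hfin := finite_perLat_norm_le d (RK + R₀)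
  rw [Measure.sum_apply _ hK.measurableSet, tsum_eq_sum (s := hfin.toFinset)]
  · exact ENNReal.sum_lt_top.2 fun γ _ => measure_lt_top _ _
  · intro γ hγ
    rw [Measure.map_apply ((measurable_rho d).add_const _) hK.measurableSet]
    convert measure_empty (μ := μHaar)
    ext U
    simp only [Set.mem_preimage, Set.mem_empty_iff_false, iff_false]
    intro hU
    apply hγ
    rw [Set.Finite.mem_toFinset, Set.mem_setOf_eq]
    calc ‖(γ : LinearMap.range d)‖
        = ‖(ρarg U + γ) - ρarg U‖ := by rw [add_sub_cancel_left]
      _ ≤ ‖ρarg U + γ‖ + ‖ρarg U‖ := norm_sub_le _ _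
      _ ≤ RK + R₀ := add_le_add (hRK _ hU) (hR₀ U)

/-- The periodised law has total mass at least one. [folklore] -/
theorem one_le_per_univ : 1 ≤ νper Set.univ := by
  rw [Measure.sum_apply _ MeasurableSet.univ]
  refine le_trans ?_ (ENNReal.le_tsum (⟨0, fun p => ⟨0, by simp⟩⟩ : Γper))
  rw [Measure.map_apply ((measurable_rho d).add_const _) MeasurableSet.univ, Set.preimage_univ,
    measure_univ]

/-- **The periodised law is a non-zero finite multiple of Lebesgue measure on `V = im d`**
(uniqueness of Haar measure on `V`). [folklore] -/
theorem per_eq_smul_volume (n : P → E → ℤ)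
    (hd : ∀ (θ : E → ℝ) (p : P), d θ p = ∑ e, (n p e : ℝ) * θ e) :
    ∃ c : ℝ≥0∞, c ≠ 0 ∧ c ≠ ∞ ∧ νper = c • volume := by
  haveI : (νper).IsAddLeftInvariant := per_isAddLeftInvariant d n hd
  haveI : IsFiniteMeasureOnCompacts νper := per_isFiniteMeasureOnCompacts d
  have hνeq : νper = ((νper).addHaarScalarFactor volume : ℝ≥0∞) • volume :=
    Measure.isAddLeftInvariant_eq_smul _ volume
  refine ⟨((νper).addHaarScalarFactor volume : ℝ≥0∞), ?_, ENNReal.coe_ne_top, hνeq⟩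
  intro hc
  have h1 := one_le_per_univ d
  rw [hνeq, hc, zero_smul, Measure.coe_zero, Pi.zero_apply] at h1
  exact absurd h1 (by simp)

end AbelianPushforward

/-- **Stub A — abelian pushforward of Haar under an integer linear map.**  For finite index
types `E` (links) and `P` (plaquettes), an `ℝ`-linear map `d : ℝ^E → ℝ^P` with INTEGER
coefficients `n`, and the product Haar probability on `Circle^E`: writing
`ρ U := d (arg ∘ U) ∈ V := im d` and `Γ := {γ ∈ V | γ_p ∈ 2πℤ ∀ p}` (the period lattice), the
`Γ`-periodised law of `ρ` is a constant multiple of Lebesgue measure on the subspace `V`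
(uniqueness of Haar measure on `V`; the sum over `Γ` is exactly translation invariant because
`arg (z w) ≡ arg z + arg w (mod 2π)` and `d (2πℤ^E) ⊆ Γ`). [folklore] -/
theorem stub_abelianPushforward {E P : Type} [Fintype E] [DecidableEq E] [Fintype P] [DecidableEq P]
    (n : P → E → ℤ) (d : (E → ℝ) →ₗ[ℝ] EuclideanSpace ℝ P)
    (hd : ∀ (θ : E → ℝ) (p : P), d θ p = ∑ e, (n p e : ℝ) * θ e) :
    ∃ c : ℝ≥0∞, c ≠ 0 ∧ c ≠ ∞ ∧
      ∀ F : LinearMap.range d → ℝ≥0∞, Measurable F →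
        ∫⁻ U : E → Circle,
            (∑' γ : {v : LinearMap.range d // ∀ p : P, ∃ m : ℤ, (v : EuclideanSpace ℝ P) p = 2 * Real.pi * m},
              F (⟨d (fun e => Complex.arg (U e : ℂ)), LinearMap.mem_range_self d _⟩ + (γ : LinearMap.range d)))
          ∂(Measure.pi fun _ : E => haarProbability Circle) =
        c * ∫⁻ v : LinearMap.range d, F v := by
  obtain ⟨c, hc0, hctop, hν⟩ := per_eq_smul_volume d n hd
  refine ⟨c, hc0, hctop, fun F hF => ?_⟩
  have h := lintegral_per d hF
  rw [hν, lintegral_smul_measure] at h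
  exact h.symm

end Summit.QuantumFields.YangMills.Theorems.SelfNormalisedSkewness.Negative

end
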